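import Mathlib
import Summits.KontsevichZagierPeriods.Zeta5Search.Families.SeatingGapRays
import Summits.KontsevichZagierPeriods.Zeta5Search.Families.CubicalChartVIMRays
import HarnessLib

/-!
# ζ(5) search — every live `M_{0,10}` ray's growth exponent is PINNED: `vimRayRate a b = −log raySup(τ_vim; α(b), a)`

HONEST FRAMING: systematic search; no irrationality claim unless certified.  Cell `pub-zeta5`, certifier 2 (cert-2 g11,
2026-08-22).  Real analysis / bookkeeping; nothing about `ζ(5)` or `ζ(7)`; no conjecture node is used; no number of record moves.

cert-2 g10's `Families/CubicalChartVIMRays.tendsto_log_leading_ray` says: for every balanced LIVE direction `d = (a;b)` of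
fam-brown9's `M_{0,10}` cone, `log A_n(d)/n → vimRayRate a b = log ⨅_u tilt` (a variational number of the ray polynomial).
This file identifies that number with a growth constant of P2's `Families/RayGrowth`: the census frame
`(3,8,5,9,7,10,2,4,1 | 6)` is the seating `τ_vim = (9,7,1,8,3,10,5,2,4,6)` (0-based `tauVim = (8,6,0,7,2,9,4,1,3,5)`), its ray
polynomial with edge exponents `β = a` (by position) IS `vimSpanProd a` (`vimSpanProd_eq_rayPoly`) and the gap exponents are
`α_w = b_{w+5}` (`vimGap_eq_rayBase`), so by `Families/SeatingGapRays.iInf_ray_tilt_eq_inv_raySup`: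
* **`vimRayRate_eq_neg_log_raySup`** — for `Balanced a b` and `VIMLive a b`:
  `vimRayRate a b = −log raySup tauVim (α(b)) a`, the reciprocal growth constant `M_{τ_vim}(α,β) = sup_{simplex} f_{τ_vim}(α,β)`
  of Brown's generalised cellular integrals of the frame seating along the ray (`Families/RayGrowth`: `I(Nα,Nβ)^{1/N} → M`
  whenever the ray lies in Brown's convergence cone); and **`tendsto_log_leading_ray_dual`**: `log A_n(d)/n → −log raySup …`.
This is the `M_{0,10}` analogue of cert-2 g9's `DualRateLiveRays.rayQRate_eq_neg_log_raySup_dual` (Brown–Zudilin rays): fam-brown9's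
MODEL exponent `b̂(d)` of every live balanced ray is minus the log of a dual-ray growth constant.  Also: the Hall predicate
`VIMLive` is a cone condition (`vimLive_smul_iff`), so **`leading_smul_eq_zero_iff`**: a balanced direction is void at one height
iff at every height (the void sub-cone of SCOREBOARD §B is a union of rays).  Standard axioms only.
-/

noncomputable section

open Finset Real Filter Topology

namespace Summit.KontsevichZagierPeriods.Zeta5Search.Families.Cellular

namespace CubicalChartN

open Summit.KontsevichZagierPeriods.Zeta5Search.Cells.VanishingMiddleLeading (Balanced leading)

/-! ## The seating of the VIM frame -/

/-- The inverse `τ_vim = (9,7,1,8,3,10,5,2,4,6)` of the frame `(3,8,5,9,7,10,2,4,1,6)` of `Families/CubicalChartVIM`, 0-based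
(`9 = ∞` is the label of the point `6`). -/
def tauVim : Fin 10 → Fin 10 := ![8, 6, 0, 7, 2, 9, 4, 1, 3, 5]

/-- `τ_vim` is the printed list read 0-based, and is injective. -/
theorem tauVim_spec : tauVim = ofSeating (ℓ := 7) [9, 7, 1, 8, 3, 10, 5, 2, 4, 6] ∧ Function.Injective tauVim :=
  ⟨by decide, by decide⟩

/-- `τ_vim` is the inverse of the frame (0-based `(2,7,4,8,6,9,1,3,0,5)` = `lab` of `Families/CubicalChartVIMDual` with `5` last). -/
theorem tauVim_inverse : ∀ i, tauVim ((![2, 7, 4, 8, 6, 9, 1, 3, 0, 5] : Fin 10 → Fin 10) i) = i ∧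
    (![2, 7, 4, 8, 6, 9, 1, 3, 0, 5] : Fin 10 → Fin 10) (tauVim i) = i := by decide

/-- The gap exponents of the frame gauge by position: `α_w = b_{w+5}` (indices mod 10; `vimGap b = (b₅,…,b₉,b₀,b₁,b₂)` on the
eight gaps, and `b₃, b₄` on the two `δ⁰`-edges through `∞`, which `rayF` ignores). -/
def vimAlpha (b : Fin 10 → ℕ) : Fin 10 → ℕ := fun w => b (w + 5)

/-! ## The dictionary -/

/-- **`vimSpanProd a` is the ray polynomial of `τ_vim` with edge exponents `a` by position** (the edges at positions
`4, 5` — `{2,9}, {9,4}` — pass through `∞ = 9`). -/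
theorem vimSpanProd_eq_rayPoly (a : Fin 10 → ℕ) : vimSpanProd a = SeatingGap.rayPoly tauVim a := by
  have t0 : SpanHall.spanPoly (SeatingGap.edgeSpan tauVim) 0 ^ SeatingGap.rayExpN tauVim a 0 =
      (MvPolynomial.X 6 + MvPolynomial.X 7) ^ a 0 := by
    rw [SpanHall.spanPoly, show SeatingGap.edgeSpan tauVim 0 = {6, 7} by decide,
      show SeatingGap.rayExpN tauVim a 0 = a 0 by simp [SeatingGap.rayExpN, tauVim]]
    simp
  have t1 : SpanHall.spanPoly (SeatingGap.edgeSpan tauVim) 1 ^ SeatingGap.rayExpN tauVim a 1 =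
      (MvPolynomial.X 0 + MvPolynomial.X 1 + MvPolynomial.X 2 + MvPolynomial.X 3 + MvPolynomial.X 4 + MvPolynomial.X 5) ^ a 1 := by
    rw [SpanHall.spanPoly, show SeatingGap.edgeSpan tauVim 1 = {0, 1, 2, 3, 4, 5} by decide,
      show SeatingGap.rayExpN tauVim a 1 = a 1 by simp [SeatingGap.rayExpN, tauVim]]
    simp [add_assoc]
  have t2 : SpanHall.spanPoly (SeatingGap.edgeSpan tauVim) 2 ^ SeatingGap.rayExpN tauVim a 2 =
      (MvPolynomial.X 0 + MvPolynomial.X 1 + MvPolynomial.X 2 + MvPolynomial.X 3 + MvPolynomial.X 4 + MvPolynomial.X 5 +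
        MvPolynomial.X 6) ^ a 2 := by
    rw [SpanHall.spanPoly, show SeatingGap.edgeSpan tauVim 2 = {0, 1, 2, 3, 4, 5, 6} by decide,
      show SeatingGap.rayExpN tauVim a 2 = a 2 by simp [SeatingGap.rayExpN, tauVim]]
    simp [add_assoc]
  have t3 : SpanHall.spanPoly (SeatingGap.edgeSpan tauVim) 3 ^ SeatingGap.rayExpN tauVim a 3 =
      (MvPolynomial.X 2 + MvPolynomial.X 3 + MvPolynomial.X 4 + MvPolynomial.X 5 + MvPolynomial.X 6) ^ a 3 := by
    rw [SpanHall.spanPoly, show SeatingGap.edgeSpan tauVim 3 = {2, 3, 4, 5, 6} by decide,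
      show SeatingGap.rayExpN tauVim a 3 = a 3 by simp [SeatingGap.rayExpN, tauVim]]
    simp [add_assoc]
  have t4 : SpanHall.spanPoly (SeatingGap.edgeSpan tauVim) 4 ^ SeatingGap.rayExpN tauVim a 4 = 1 := by
    rw [show SeatingGap.rayExpN tauVim a 4 = 0 by simp [SeatingGap.rayExpN, tauVim], pow_zero]
  have t5 : SpanHall.spanPoly (SeatingGap.edgeSpan tauVim) 5 ^ SeatingGap.rayExpN tauVim a 5 = 1 := by
    rw [show SeatingGap.rayExpN tauVim a 5 = 0 by simp [SeatingGap.rayExpN, tauVim], pow_zero]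
  have t6 : SpanHall.spanPoly (SeatingGap.edgeSpan tauVim) 6 ^ SeatingGap.rayExpN tauVim a 6 =
      (MvPolynomial.X 1 + MvPolynomial.X 2 + MvPolynomial.X 3) ^ a 6 := by
    rw [SpanHall.spanPoly, show SeatingGap.edgeSpan tauVim 6 = {1, 2, 3} by decide,
      show SeatingGap.rayExpN tauVim a 6 = a 6 by simp [SeatingGap.rayExpN, tauVim]]
    simp [add_assoc]
  have t7 : SpanHall.spanPoly (SeatingGap.edgeSpan tauVim) 7 ^ SeatingGap.rayExpN tauVim a 7 =
      (MvPolynomial.X 1 + MvPolynomial.X 2) ^ a 7 := by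
    rw [SpanHall.spanPoly, show SeatingGap.edgeSpan tauVim 7 = {1, 2} by decide,
      show SeatingGap.rayExpN tauVim a 7 = a 7 by simp [SeatingGap.rayExpN, tauVim]]
    simp
  have t8 : SpanHall.spanPoly (SeatingGap.edgeSpan tauVim) 8 ^ SeatingGap.rayExpN tauVim a 8 =
      (MvPolynomial.X 3 + MvPolynomial.X 4) ^ a 8 := by
    rw [SpanHall.spanPoly, show SeatingGap.edgeSpan tauVim 8 = {3, 4} by decide,
      show SeatingGap.rayExpN tauVim a 8 = a 8 by simp [SeatingGap.rayExpN, tauVim]]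
    simp
  have t9 : SpanHall.spanPoly (SeatingGap.edgeSpan tauVim) 9 ^ SeatingGap.rayExpN tauVim a 9 =
      (MvPolynomial.X 5 + MvPolynomial.X 6 + MvPolynomial.X 7) ^ a 9 := by
    rw [SpanHall.spanPoly, show SeatingGap.edgeSpan tauVim 9 = {5, 6, 7} by decide,
      show SeatingGap.rayExpN tauVim a 9 = a 9 by simp [SeatingGap.rayExpN, tauVim]]
    simp [add_assoc]
  unfold SeatingGap.rayPoly SpanHall.spanProd
  show _ = ∏ i : Fin 10, SpanHall.spanPoly (SeatingGap.edgeSpan tauVim) i ^ SeatingGap.rayExpN tauVim a i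
  simp only [Fin.prod_univ_succ, Fin.prod_univ_zero, Fin.isValue, Fin.succ_zero_eq_one, Fin.succ_one_eq_two, Fin.reduceSucc,
    t0, t1, t2, t3, t4, t5, t6, t7, t8, t9]
  unfold vimSpanProd
  ring

/-- **The gap exponents**: `vimGap b` (on the eight gaps) is the base vector `rayBase (vimAlpha b)`. -/
theorem vimGap_eq_rayBase (b : Fin 10 → ℕ) :
    Finsupp.equivFunOnFinite.symm (vimGap b) = SeatingGap.rayBase (vimAlpha b) := by
  ext w
  simp only [Finsupp.coe_equivFunOnFinite_symm, SeatingGap.rayBase, vimAlpha]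
  fin_cases w <;> simp [vimGap]

/-- The ray polynomials agree over `ℝ`. -/
theorem vimPolyRa_eq_rayPolyR (a : Fin 10 → ℕ) : vimPolyRa a = SeatingGap.rayPolyR tauVim a := by
  rw [vimPolyRa, SeatingGap.rayPolyR, vimSpanProd_eq_rayPoly]

/-- On a live balanced direction the ray is live in the sense of `Families/SeatingGapRays`: `rayCT τ_vim α a 1 = leading a b ≠ 0`. -/
theorem rayCT_tauVim_one {a b : Fin 10 → ℕ} (h : Balanced a b) :
    SeatingGap.rayCT tauVim (vimAlpha b) a 1 = leading a b := by
  rw [SeatingGap.rayCT, pow_one, one_smul, ← vimGap_eq_rayBase, ← vimSpanProd_eq_rayPoly, leading_eq_vimDualCT a b h]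
  rfl

/-! ## The identification -/

/-- **`vimRayRate a b = −log raySup(τ_vim; α(b), a)`** for every balanced live direction: fam-brown9's growth exponent of the
leading coefficients along `d = (a;b)` is minus the log of the growth constant of the generalised cellular integrals of the frame
seating along the ray (gap exponents `α_w = b_{w+5}`, edge exponents `a`). -/
theorem vimRayRate_eq_neg_log_raySup {a b : Fin 10 → ℕ} (h : Balanced a b) (hl : VIMLive a b) :
    vimRayRate a b = -Real.log (raySup tauVim (fun i => (vimAlpha b i : ℤ)) (fun i => (a i : ℤ))) := by
  have hlive : SeatingGap.rayCT tauVim (vimAlpha b) a 1 ≠ 0 := by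
    rw [rayCT_tauVim_one h]; exact (leading_ne_zero_iff_live a b h).2 hl
  unfold vimRayRate
  rw [vimGap_eq_rayBase, vimPolyRa_eq_rayPolyR, SeatingGap.iInf_ray_tilt_eq_inv_raySup tauVim (vimAlpha b) a tauVim_spec.2 hlive,
    Real.log_inv]

/-- **`log A_n(d)/n → −log raySup(τ_vim; α(b), a)`** for every balanced live direction `d = (a;b)`. -/
theorem tendsto_log_leading_ray_dual {a b : Fin 10 → ℕ} (h : Balanced a b) (hl : VIMLive a b) :
    Tendsto (fun n : ℕ => Real.log (leading (n • a) (n • b) : ℝ) / n) atTop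
      (𝓝 (-Real.log (raySup tauVim (fun i => (vimAlpha b i : ℤ)) (fun i => (a i : ℤ))))) := by
  rw [← vimRayRate_eq_neg_log_raySup h hl]
  exact tendsto_log_leading_ray h hl

/-- **Liveness bounds the dual ray function**: on a live balanced direction Brown's ray function of the frame seating is
`≤ 1` on the whole open simplex (so `raySup ≤ 1`, `vimRayRate a b ≥ 0`: the leading coefficients do not decay). -/
theorem vimRayRate_nonneg {a b : Fin 10 → ℕ} (h : Balanced a b) (hl : VIMLive a b) : 0 ≤ vimRayRate a b := by
  have hlive : SeatingGap.rayCT tauVim (vimAlpha b) a 1 ≠ 0 := by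
    rw [rayCT_tauVim_one h]; exact (leading_ne_zero_iff_live a b h).2 hl
  rw [vimRayRate_eq_neg_log_raySup h hl, le_neg, neg_zero]
  apply Real.log_nonpos
  · obtain ⟨t, ht⟩ := openSimplex_nonempty 7
    exact (rayF_pos tauVim _ _ tauVim_spec.2 ht).le.trans
      (le_csSup (SeatingGap.bddAbove_rayF_of_live tauVim (vimAlpha b) a tauVim_spec.2 hlive) ⟨t, ht, rfl⟩)
  · exact csSup_le ((openSimplex_nonempty 7).image _)
      (by rintro _ ⟨t, ht, rfl⟩; exact SeatingGap.rayF_le_one_of_live tauVim (vimAlpha b) a tauVim_spec.2 hlive ht)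

/-! ## The void sub-cone is a union of rays -/

/-- The gap exponents scale along a ray: `vimGap (n·b) w = n · vimGap b w`. -/
theorem vimGap_smul_apply (n : ℕ) (b : Fin 10 → ℕ) (w : Fin 8) : vimGap (n • b) w = n * vimGap b w := by
  have h := congrArg (fun f => f w) (vimGap_smul n b)
  simpa using h

/-- **The Hall predicate is a cone condition**: `VIMLive (n·a) (n·b) ↔ VIMLive a b` for `n ≥ 1`. -/
theorem vimLive_smul_iff {n : ℕ} (hn : 1 ≤ n) (a b : Fin 10 → ℕ) : VIMLive (n • a) (n • b) ↔ VIMLive a b := by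
  unfold VIMLive
  have hscale : ∀ S : Finset (Fin 8), (∑ e ∈ S, (n • a) (vimEdge e)) = n * ∑ e ∈ S, a (vimEdge e) ∧
      (∑ w ∈ S.biUnion vimSpan, vimGap (n • b) w) = n * ∑ w ∈ S.biUnion vimSpan, vimGap b w := by
    intro S
    refine ⟨?_, ?_⟩
    · rw [Finset.mul_sum]; exact Finset.sum_congr rfl fun e _ => by simp
    · rw [Finset.mul_sum]; exact Finset.sum_congr rfl fun w _ => vimGap_smul_apply n b w
  constructor
  · intro h S
    have := h S
    rw [(hscale S).1, (hscale S).2] at this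
    exact Nat.le_of_mul_le_mul_left this (by omega)
  · intro h S
    rw [(hscale S).1, (hscale S).2]
    exact Nat.mul_le_mul_left n (h S)

/-- **A direction is void at one height iff at every height**: for balanced `(a,b)` and `n ≥ 1`,
`leading (n·a) (n·b) = 0 ↔ leading a b = 0` (the void sub-cone of the `M_{0,10}` census is a union of rays; compare
`Brown8/LeadingCoefficientCone.QOf_smul_eq_zero_iff` for Brown–Zudilin's `Q`). -/
theorem leading_smul_eq_zero_iff {a b : Fin 10 → ℕ} (h : Balanced a b) {n : ℕ} (hn : 1 ≤ n) :
    leading (n • a) (n • b) = 0 ↔ leading a b = 0 := by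
  have h1 := leading_ne_zero_iff_live (n • a) (n • b) (balanced_smul n h)
  have h2 := leading_ne_zero_iff_live a b h
  rw [vimLive_smul_iff hn] at h1
  constructor
  · intro hz; by_contra hne; exact (h1.2 (h2.1 hne)) hz
  · intro hz; by_contra hne; exact (h2.2 (h1.1 hne)) hz

end CubicalChartN

end Summit.KontsevichZagierPeriods.Zeta5Search.Families.Cellular
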